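import Literature.InformationTheory.Entropy.VonNeumannEntropyInequalities
import Literature.LinearAlgebra.Matrix.HermitianCfcDiagonalForm
import Literature.MathematicalPhysics.QuantumLattice.KroneckerPartialTrace
import HarnessLib

/-!
# Weak monotonicity (and strong subadditivity) of the von Neumann entropy FROM the monotonicity
# of the relative entropy under the partial trace

Topic `InformationTheory/Entropy`, namespace `Literature.InformationTheory.Entropy`. The tree's
`VonNeumannEntropyInequalities.lean` vendors two NAMED FACTS for finite quantum systems:
`weak_monotonicity` (Lieb–Ruskai 1973: `S(ρ_X) + S(ρ_Y) ≤ S(ρ_{XS}) + S(ρ_{SY})`) and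
`relEntropy_partialTrace_le` (Lindblad 1975: `S(Tr_i ρ ‖ Tr_i σ) ≤ S(ρ‖σ)`, `σ` and its marginals
positive definite, `ρ` any density). This file PROVES

  `weak_monotonicity_of_relEntropy_partialTrace_le : relEntropy_partialTrace_le → weak_monotonicity`,

so the first fact is a COROLLARY of the second, and — the second being discharged in the tree
(`relEntropy_partialTrace_le_holds`, Petz's proof of Lindblad's inequality) — DISCHARGES it:
`theorem weak_monotonicity_holds : weak_monotonicity`. No definition and no named fact is
introduced; both facts' statements are untouched. The argument is the printed one:

1. **Monotonicity under `Tr_C` ⇒ strong subadditivity** (Ruskai 2002, §1.2 eqs. (6)–(7): "Strong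
   subadditivity can now be restated as `H(ρ₁₂, ρ₂) ≤ H(ρ₁₂₃, ρ₂₃)` where `ρ₂₃` means
   `I₁ ⊗ ρ₂₃` … This monotonicity implies [it] when `Φ = T₃` is the partial trace"; §5.3
   "MONO ⇒ MPT ⇔ SSA"; Nielsen–Chuang eq. (11.106) `S(A|B) = log d − S(ρ^{AB} ‖ I/d ⊗ ρ^B)`).
   Lindblad's inequality is applied ONCE, on `(A × B) × C`, to the pair `(τ, 𝟙_A/|A| ⊗ ω)` with
   `ω` a POSITIVE DEFINITE density on `B × C` (as the vendored fact demands; `τ` may be singular),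
   giving the variational inequality `re_trace_log_sub_le_entropy_sub`
   `Re Tr(τ_{BC} log ω) − Re Tr(τ_B log ω_B) ≤ S(τ_{AB}) − S(τ)`; the regularised states
   `ω_ε = (1−ε) τ_{BC} + ε𝟙/(|B||C|)` and `ε → 0⁺` (`tendsto_re_trace_mul_cfc_log_perturb`, the
   finite-dimensional "approximation argument", Petz 2008 proof of Thm 3.10) then give
   `strongSubadditivity_of_relEntropy_partialTrace_le`:
   `S(τ) + S(τ_B) ≤ S(τ_{AB}) + S(τ_{BC})` for EVERY density `τ` on `A × B × C`
   (Nielsen–Chuang Theorem 11.14, (11.108)).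
2. **Strong subadditivity ⇒ weak monotonicity by purification** (Nielsen–Chuang, proof of
   Theorem 11.14: (11.107) and (11.108) "are in fact equivalent … introduce an auxiliary system `R`
   purifying the system `ABC`", Exercise 11.24 for this direction; Ruskai 2002 §3.3 "By purifying
   `ρ₁₂₃` to `ρ₁₂₃₄` one can similarly show that SSA is equivalent to
   `S(ρ₄) + S(ρ₂) ≤ S(ρ₁₂) + S(ρ₁₄)`"). Concretely `ρ = M Mᴴ` (`0 ≤ ρ ⇔ ρ = Bᴴ B`), the
   reshaped `M₁ : (S × X × T) × Y` (`T = X × S × Y` the purifying copy) has `τ = M₁ M₁ᴴ` = the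
   `Y`-less marginal of the pure state `vec M`, and the "mirror lemma"
   `vonNeumannEntropy_mul_conjTranspose_comm : S(M Mᴴ) = S(Mᴴ M)` (Nielsen–Chuang Thm 11.8 (3),
   "from the Schmidt decomposition … the eigenvalues of the density operators of systems A and B
   are the same"; here from `Matrix.charpoly_mul_comm'`) supplies the two purity identities.

## Contents (all PROVED)

* `vonNeumannEntropy_mul_conjTranspose_comm`, `vonNeumannEntropy_transpose` — `S(MMᴴ) = S(MᴴM)`,
  `S(Nᵀ) = S(N)`;
* `re_trace_mul_cfc_smul_add_smul_one`, `tendsto_re_trace_mul_cfc_log_perturb` —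
  `Re Tr(P f(aP + b𝟙)) = Σᵢ λᵢ f(aλᵢ + b)` and `Re Tr(P log((1−ε)P + εd𝟙)) → −S(P)`;
* `cfc_diagonal_kronecker` — `f(c𝟙_A ⊗ N) = 𝟙_A ⊗ f(c ·)(N)`; marginals of `(M ⊗ ω)` on
  `(A × B) × C`; `re_trace_mul_one_kronecker_add_smul_one` (duality with the ampliation);
* `re_trace_log_sub_le_entropy_sub` — the variational inequality from one use of the fact;
* `strongSubadditivity_of_relEntropy_partialTrace_le` — SSA in the tree's `X × S × Y` vocabulary
  (`traceLast`, `traceLeft`), from the fact;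
* `weak_monotonicity_of_relEntropy_partialTrace_le` — the bridge between the two named facts;
* `weak_monotonicity_holds` — the discharge of `weak_monotonicity`.

## References

* M. B. Ruskai, *Inequalities for quantum entropy: a review with conditions for equality*,
  J. Math. Phys. 43 (2002) 4358–4375 = arXiv:quant-ph/0205064, §1.2 eqs. (6)–(7), §3.3, §5.3.
  [Ruskai2002]
* M. A. Nielsen, I. L. Chuang, *Quantum Computation and Quantum Information* (10th anniversary
  ed., CUP 2010), Theorem 11.8 (3) p.513; Corollary 11.13 proof eqs. (11.104)–(11.106) and
  Theorem 11.14 with its proof (11.107)–(11.112), Exercise 11.24, p.521; Theorem 11.17 p.524;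
  §2.4.3 eq. (2.178). [NielsenChuang2010]
* E. H. Lieb, M. B. Ruskai, *Proof of the strong subadditivity of quantum-mechanical entropy*,
  J. Math. Phys. 14 (1973) 1938–1941. [LiebRuskai1973]
* G. Lindblad, *Completely positive maps and entropy inequalities*, Commun. Math. Phys. 40 (1975)
  147–151, Lemma 2. [Lindblad1975]
* D. Petz, *Quantum Information Theory and Quantum Statistics* (Springer 2008), proof of
  Theorem 3.10 (approximation remark). [Petz2008]
* R. A. Horn, C. R. Johnson, *Matrix Analysis*, 2nd ed. (CUP 2013), §4.1 Theorem 4.1.5.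
  [HornJohnson2013]

## Mathlib / tree

Used: `Matrix.charpoly_mul_comm'`, `Matrix.charpoly_transpose`, `Polynomial.roots_mul`,
`Polynomial.roots_X_pow`, `CStarAlgebra.nonneg_iff_eq_star_mul_self`, `Matrix.PosDef.kronecker`,
`Matrix.PosDef.posSemidef_add`, `Matrix.trace_kronecker`, `cfc_congr/cfc_add/cfc_const`,
`ContinuousAt.log`, `le_of_tendsto`; the tree's `cfc_eq_conj_diagonal`, `cfc_submatrix_equiv`,
`trace_unitary_conj` (`HermitianCfcDiagonalForm`), `trace_mul_traceLeft_eq_kronecker`,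
`posSemidef_traceLeft/Right`, `traceLeft/Right_kronecker` (`KroneckerPartialTrace`),
`vonNeumannEntropy_eq_sum_roots_charpoly`, `re_trace_mul_cfc_log`, `traceLast`
(`VonNeumannEntropyInequalities`).
-/

noncomputable section

open Matrix Filter Topology Polynomial
open scoped MatrixOrder ComplexOrder Kronecker BigOperators

namespace Literature.InformationTheory.Entropy

open Literature.Computability.QuantumComplexity (traceLeft traceRight IsDensity traceLeft_apply
  traceRight_apply trace_traceLeft trace_traceRight)
open Literature.LinearAlgebra.Matrix (cfc_eq_conj_diagonal trace_unitary_conj cfc_submatrix_equiv)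
open Literature.MathematicalPhysics.QuantumLattice (posSemidef_traceLeft posSemidef_traceRight
  isDensity_traceLeft isDensity_traceRight trace_mul_traceLeft_eq_kronecker trace_submatrix_equiv_equiv)

/-! ### The mirror lemma: `S(M Mᴴ) = S(Mᴴ M)` -/

section Mirror

variable {m k : Type*} [Fintype m] [Fintype k] [DecidableEq m] [DecidableEq k]

/-- Prepending zero roots does not change the entropy sum `Σ η(Re z)` over the roots. [folklore] -/
private theorem sum_negMulLog_roots_X_pow_mul (p : ℂ[X]) (hp : p ≠ 0) (j : ℕ) :
    ((X ^ j * p).roots.map (fun z : ℂ => Real.negMulLog z.re)).sum =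
      (p.roots.map (fun z : ℂ => Real.negMulLog z.re)).sum := by
  rw [Polynomial.roots_mul (mul_ne_zero (pow_ne_zero _ Polynomial.X_ne_zero) hp),
    Polynomial.roots_X_pow, Multiset.map_add, Multiset.sum_add, Multiset.map_nsmul,
    Multiset.sum_nsmul, Multiset.map_singleton, Multiset.sum_singleton]
  simp

/-- **The two Gram matrices of a rectangular matrix have the same entropy**: `S(M Mᴴ) = S(Mᴴ M)`
(their characteristic polynomials differ by a power of `X`, `Matrix.charpoly_mul_comm'`, and
`η(0) = 0`). For the coefficient matrix `M` of a pure state `ψ ∈ ℋ_A ⊗ ℋ_B` these are the two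
reduced density matrices, so this is `S(ρ^A) = S(ρ^B)` for a pure bipartite state.
[cite: NielsenChuang2010, Theorem 11.8 (3) p.513 ("the eigenvalues of the density operators of
systems A and B are the same … so S(A) = S(B)")] [cite: Ruskai2002, §3.3 (purification:
"moreover, S(ρ₁) = S(ρ₂)")] -/
theorem vonNeumannEntropy_mul_conjTranspose_comm (M : Matrix m k ℂ) :
    vonNeumannEntropy (M * Mᴴ) = vonNeumannEntropy (Mᴴ * M) := by
  rw [vonNeumannEntropy_eq_sum_roots_charpoly (Matrix.isHermitian_mul_conjTranspose_self M),
    vonNeumannEntropy_eq_sum_roots_charpoly (Matrix.isHermitian_conjTranspose_mul_self M),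
    ← sum_negMulLog_roots_X_pow_mul _ (Matrix.charpoly_monic _).ne_zero (Fintype.card k),
    ← sum_negMulLog_roots_X_pow_mul (Mᴴ * M).charpoly (Matrix.charpoly_monic _).ne_zero
      (Fintype.card m), Matrix.charpoly_mul_comm']

/-- `S(Nᵀ) = S(N)` for Hermitian `N` (same characteristic polynomial; "the entropy is determined
completely by the eigenvalues"). [cite: NielsenChuang2010, Theorem 11.8 (3) (proof) p.513] -/
theorem vonNeumannEntropy_transpose {N : Matrix m m ℂ} (hN : N.IsHermitian) :
    vonNeumannEntropy Nᵀ = vonNeumannEntropy N :=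
  vonNeumannEntropy_eq_of_charpoly_eq hN.transpose hN (Matrix.charpoly_transpose N)

end Mirror


/-! ### Functions of a matrix in a fixed eigenbasis; the perturbation `(1−ε)P + εd·𝟙` -/

section Perturbation

variable {k : Type*} [Fintype k] [DecidableEq k]

/-- Product of two matrices diagonal in the same unitary basis. [folklore] -/
private theorem conj_diagonal_mul_conj_diagonal {V : Matrix k k ℂ} (hV : V ∈ Matrix.unitaryGroup k ℂ)
    (d d' : k → ℂ) :
    V * diagonal d * star V * (V * diagonal d' * star V) = V * diagonal (fun i => d i * d' i) * star V := by
  calc V * diagonal d * star V * (V * diagonal d' * star V)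
      = V * (diagonal d * ((star V * V) * diagonal d')) * star V := by simp only [Matrix.mul_assoc]
    _ = V * diagonal (fun i => d i * d' i) * star V := by
        rw [Unitary.star_mul_self_of_mem hV, Matrix.one_mul, diagonal_mul_diagonal]

omit [Fintype k] in
/-- `a•diag(μ) + b•𝟙 = diag(a μ + b)`. [folklore] -/
private theorem smul_diagonal_add_smul_one (μ : k → ℝ) (a b : ℝ) :
    (a : ℂ) • diagonal (fun i => ((μ i : ℝ) : ℂ)) + (b : ℂ) • (1 : Matrix k k ℂ) =
      diagonal (fun i => ((a * μ i + b : ℝ) : ℂ)) := by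
  ext i j
  by_cases hij : i = j
  · subst hij; simp
  · simp [hij, Matrix.one_apply_ne hij]

/-- **`Re Tr (P · f(aP + b𝟙)) = Σᵢ λᵢ f(aλᵢ + b)`** for Hermitian `P` with eigenvalues `λᵢ`: `P` and
`aP + b𝟙` are diagonal in the same eigenbasis, so the matrix function is computed eigenvalue-wise
(`cfc_eq_conj_diagonal`: the functional calculus from ANY unitary diagonalisation).
[cite: HornJohnson2013, §4.1 Theorem 4.1.5] [cite: NielsenChuang2010, §11.3 eq. (11.40)] -/
theorem re_trace_mul_cfc_smul_add_smul_one {P : Matrix k k ℂ} (hP : P.IsHermitian) (f : ℝ → ℝ)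
    (a b : ℝ) :
    ((P * cfc f ((a : ℂ) • P + (b : ℂ) • (1 : Matrix k k ℂ))).trace).re =
      ∑ i, hP.eigenvalues i * f (a * hP.eigenvalues i + b) := by
  set V : Matrix k k ℂ := (hP.eigenvectorUnitary : Matrix k k ℂ) with hV
  have hVu : V ∈ Matrix.unitaryGroup k ℂ := hP.eigenvectorUnitary.2
  have hPV : P = V * diagonal (fun i => ((hP.eigenvalues i : ℝ) : ℂ)) * star V := hP.spectral_theorem
  have hQV : (a : ℂ) • P + (b : ℂ) • (1 : Matrix k k ℂ) =
      V * diagonal (fun i => ((a * hP.eigenvalues i + b : ℝ) : ℂ)) * star V := by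
    have h1 : (1 : Matrix k k ℂ) = V * 1 * star V := by
      rw [Matrix.mul_one, Unitary.mul_star_self_of_mem hVu]
    calc (a : ℂ) • P + (b : ℂ) • (1 : Matrix k k ℂ)
        = (a : ℂ) • (V * diagonal (fun i => ((hP.eigenvalues i : ℝ) : ℂ)) * star V) +
            (b : ℂ) • (V * 1 * star V) := by rw [← hPV, ← h1]
      _ = V * ((a : ℂ) • diagonal (fun i => ((hP.eigenvalues i : ℝ) : ℂ)) + (b : ℂ) • 1) * star V := by
          rw [Matrix.mul_add, Matrix.add_mul, Matrix.mul_smul, Matrix.smul_mul, Matrix.mul_smul,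
            Matrix.smul_mul]
      _ = _ := by rw [smul_diagonal_add_smul_one]
  have hprod : P * cfc f ((a : ℂ) • P + (b : ℂ) • (1 : Matrix k k ℂ)) =
      V * diagonal (fun i => ((hP.eigenvalues i * f (a * hP.eigenvalues i + b) : ℝ) : ℂ)) * star V := by
    calc P * cfc f ((a : ℂ) • P + (b : ℂ) • (1 : Matrix k k ℂ))
        = P * (V * diagonal (fun i => ((f (a * hP.eigenvalues i + b) : ℝ) : ℂ)) * star V) := by
          rw [cfc_eq_conj_diagonal hVu hQV f]; rfl
      _ = V * diagonal (fun i => ((hP.eigenvalues i : ℝ) : ℂ)) * star V *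
            (V * diagonal (fun i => ((f (a * hP.eigenvalues i + b) : ℝ) : ℂ)) * star V) := by rw [← hPV]
      _ = _ := by
          rw [conj_diagonal_mul_conj_diagonal hVu]
          push_cast
          rfl
  rw [hprod, trace_unitary_conj hVu, trace_diagonal]
  rw [← Complex.ofReal_sum]  -- may need massaging
  exact Complex.ofReal_re _

/-- **The regularising perturbation**: for `P ⪰ 0` with eigenvalues `λᵢ`,
`Re Tr (P log((1−ε)P + εd𝟙)) = Σᵢ λᵢ log((1−ε)λᵢ + εd) → Σᵢ λᵢ log λᵢ = −S(P)` as `ε → 0⁺`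
(the terms with `λᵢ = 0` vanish identically; the others are continuous at `ε = 0`). This is the
finite-dimensional "approximation argument" by which entropy inequalities for faithful states extend
to all states. [cite: Petz2008, proof of Theorem 3.10 ("the general case can be covered by an
approximation argument")] [cite: NielsenChuang2010, §11.3 eq. (11.40)] -/
theorem tendsto_re_trace_mul_cfc_log_perturb {P : Matrix k k ℂ} (hP : P.PosSemidef) (d : ℝ) :
    Tendsto (fun ε : ℝ =>
        ((P * cfc Real.log (((1 - ε : ℝ) : ℂ) • P + ((ε * d : ℝ) : ℂ) • (1 : Matrix k k ℂ))).trace).re)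
      (𝓝[>] 0) (𝓝 (- vonNeumannEntropy P)) := by
  simp_rw [re_trace_mul_cfc_smul_add_smul_one hP.1 Real.log]
  rw [vonNeumannEntropy_eq hP.1, ← Finset.sum_neg_distrib]
  refine tendsto_finsetSum _ fun i _ => ?_
  have hlim : - Real.negMulLog (hP.1.eigenvalues i) =
      hP.1.eigenvalues i * Real.log ((1 - 0) * hP.1.eigenvalues i + 0 * d) := by
    simp [Real.negMulLog]
  rw [hlim]
  rcases (hP.eigenvalues_nonneg i).eq_or_lt with h0 | hpos
  · simp only [← h0, zero_mul]
    exact tendsto_const_nhds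
  · refine ContinuousAt.tendsto ?_ |>.mono_left nhdsWithin_le_nhds
    refine continuousAt_const.mul (ContinuousAt.log (by fun_prop) ?_)
    simp [hpos.ne']

end Perturbation

/-! ### The comparison state `(𝟙_A/|A|) ⊗ ω`: its matrix functions and marginals -/

section Ampliation

variable {A k : Type*} [Fintype A] [DecidableEq A] [Fintype k] [DecidableEq k]

/-- `diag(κ) ⊗ (V diag(d) V*) = (𝟙 ⊗ V) diag(κ ⊗ d) (𝟙 ⊗ V)*`. [folklore] -/
private theorem diagonal_kronecker_conj_diagonal (κ : A → ℂ) (V : Matrix k k ℂ) (d : k → ℂ) :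
    diagonal κ ⊗ₖ (V * diagonal d * star V) =
      ((1 : Matrix A A ℂ) ⊗ₖ V) * diagonal (fun p : A × k => κ p.1 * d p.2) *
        star ((1 : Matrix A A ℂ) ⊗ₖ V) := by
  simp only [Matrix.star_eq_conjTranspose, Matrix.conjTranspose_kronecker, Matrix.conjTranspose_one]
  rw [← diagonal_kronecker_diagonal, ← Matrix.mul_kronecker_mul, ← Matrix.mul_kronecker_mul,
    Matrix.one_mul, Matrix.mul_one]

/-- `𝟙 ⊗ (V diag(d) V*) = (𝟙 ⊗ V) diag(d ∘ snd) (𝟙 ⊗ V)*`. [folklore] -/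
private theorem one_kronecker_conj_diagonal (V : Matrix k k ℂ) (d : k → ℂ) :
    (1 : Matrix A A ℂ) ⊗ₖ (V * diagonal d * star V) =
      ((1 : Matrix A A ℂ) ⊗ₖ V) * diagonal (fun p : A × k => d p.2) * star ((1 : Matrix A A ℂ) ⊗ₖ V) := by
  have h := diagonal_kronecker_conj_diagonal (fun _ : A => (1 : ℂ)) V d
  simp only [one_mul, Matrix.diagonal_one] at h
  exact h

/-- `𝟙_A ⊗ V` is unitary for unitary `V`. [folklore] -/
private theorem one_kronecker_mem_unitaryGroup {V : Matrix k k ℂ} (hV : V ∈ Matrix.unitaryGroup k ℂ) :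
    (1 : Matrix A A ℂ) ⊗ₖ V ∈ Matrix.unitaryGroup (A × k) ℂ := by
  rw [Matrix.mem_unitaryGroup_iff, Matrix.star_eq_conjTranspose, Matrix.conjTranspose_kronecker,
    Matrix.conjTranspose_one, ← Matrix.mul_kronecker_mul, Matrix.one_mul,
    ← Matrix.star_eq_conjTranspose, Unitary.mul_star_self_of_mem hV, Matrix.one_kronecker_one]

/-- **Matrix functions of a scaled ampliation**: `f(c𝟙_A ⊗ N) = 𝟙_A ⊗ (f(c ·))(N)` for Hermitian `N`
(both sides are `(𝟙 ⊗ V) diag(f(c λ)) (𝟙 ⊗ V)*` in an eigenbasis `V` of `N`). With `f = log`,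
`c = 1/|A|` this is `log (𝟙_A/|A| ⊗ ω) = 𝟙_A ⊗ log ω − log |A|`, the identity behind
`S(ρ^{AB} ‖ I/d ⊗ ρ^B) = log d − S(A|B)`. [cite: NielsenChuang2010, Corollary 11.13 (proof)
eqs. (11.104)–(11.106) p.521] [cite: HornJohnson2013, §4.1 Theorem 4.1.5] -/
theorem cfc_diagonal_kronecker {N : Matrix k k ℂ} (hN : N.IsHermitian) (c : ℝ) (f : ℝ → ℝ) :
    cfc f (diagonal (fun _ : A => (c : ℂ)) ⊗ₖ N) =
      (1 : Matrix A A ℂ) ⊗ₖ cfc (fun x => f (c * x)) N := by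
  set V : Matrix k k ℂ := (hN.eigenvectorUnitary : Matrix k k ℂ) with hV
  have hVu : V ∈ Matrix.unitaryGroup k ℂ := hN.eigenvectorUnitary.2
  have hNV : N = V * diagonal (fun i => ((hN.eigenvalues i : ℝ) : ℂ)) * star V := hN.spectral_theorem
  have hWu : (1 : Matrix A A ℂ) ⊗ₖ V ∈ Matrix.unitaryGroup (A × k) ℂ := one_kronecker_mem_unitaryGroup hVu
  have hL : diagonal (fun _ : A => (c : ℂ)) ⊗ₖ N = ((1 : Matrix A A ℂ) ⊗ₖ V) *
      diagonal (fun p : A × k => ((c * hN.eigenvalues p.2 : ℝ) : ℂ)) * star ((1 : Matrix A A ℂ) ⊗ₖ V) := by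
    conv_lhs => rw [hNV]
    rw [diagonal_kronecker_conj_diagonal]
    push_cast
    rfl
  have hR : (1 : Matrix A A ℂ) ⊗ₖ cfc (fun x => f (c * x)) N = ((1 : Matrix A A ℂ) ⊗ₖ V) *
      diagonal (fun p : A × k => ((f (c * hN.eigenvalues p.2) : ℝ) : ℂ)) *
        star ((1 : Matrix A A ℂ) ⊗ₖ V) := by
    have h1 : cfc (fun x => f (c * x)) N =
        V * diagonal (fun i => ((f (c * hN.eigenvalues i) : ℝ) : ℂ)) * star V :=
      cfc_eq_conj_diagonal hVu hNV (fun x => f (c * x))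
    rw [h1]
    exact one_kronecker_conj_diagonal V (fun i => ((f (c * hN.eigenvalues i) : ℝ) : ℂ))
  rw [hR]
  exact cfc_eq_conj_diagonal hWu hL f

variable {B C : Type*} [Fintype B] [DecidableEq B] [Fintype C] [DecidableEq C]

omit [Fintype A] [DecidableEq A] [Fintype B] [DecidableEq B] [DecidableEq C] in
/-- `Tr_C` of `(M ⊗ ω)` on `(A × B) × C` is `M ⊗ Tr_C ω`. [cite: NielsenChuang2010, §2.4.3 eq. (2.178)] -/
theorem traceRight_kronecker_submatrix_prodAssoc (Mx : Matrix A A ℂ) (ω : Matrix (B × C) (B × C) ℂ) :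
    traceRight ((Mx ⊗ₖ ω).submatrix (Equiv.prodAssoc A B C) (Equiv.prodAssoc A B C)) =
      Mx ⊗ₖ traceRight ω := by
  ext ⟨a, b⟩ ⟨a', b'⟩
  simp only [traceRight_apply, Matrix.submatrix_apply, Equiv.prodAssoc_apply,
    Matrix.kroneckerMap_apply, Finset.mul_sum]

omit [DecidableEq A] [DecidableEq B] [Fintype C] [DecidableEq C] in
/-- `Tr_{AB}` of `(M ⊗ ω)` on `(A × B) × C` is `Tr(M) · Tr_B ω`. [cite: NielsenChuang2010, §2.4.3 eq. (2.178)] -/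
theorem traceLeft_kronecker_submatrix_prodAssoc (Mx : Matrix A A ℂ) (ω : Matrix (B × C) (B × C) ℂ) :
    traceLeft ((Mx ⊗ₖ ω).submatrix (Equiv.prodAssoc A B C) (Equiv.prodAssoc A B C)) =
      Mx.trace • traceLeft ω := by
  ext z z'
  simp only [traceLeft_apply, Matrix.submatrix_apply, Equiv.prodAssoc_apply,
    Matrix.kroneckerMap_apply, Matrix.smul_apply, smul_eq_mul, Matrix.trace, Matrix.diag_apply,
    Fintype.sum_prod_type, Finset.sum_mul, Finset.mul_sum]
  exact Finset.sum_comm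

/-- `Re Tr (ρ (𝟙_A ⊗ L + r𝟙)) = Re Tr (L · Tr_A ρ) + r Re Tr ρ` — the duality of the partial trace with
the ampliation, plus the scalar part. [cite: NielsenChuang2010, §2.4.3 Box 2.6 eq. (2.180)] -/
theorem re_trace_mul_one_kronecker_add_smul_one (ρ : Matrix (A × k) (A × k) ℂ) (L : Matrix k k ℂ)
    (r : ℝ) :
    ((ρ * ((1 : Matrix A A ℂ) ⊗ₖ L + (r : ℂ) • (1 : Matrix (A × k) (A × k) ℂ))).trace).re =
      ((L * traceLeft ρ).trace).re + r * (ρ.trace).re := by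
  rw [Matrix.mul_add, Matrix.trace_add, Complex.add_re, Matrix.mul_smul, Matrix.mul_one,
    Matrix.trace_smul, trace_mul_traceLeft_eq_kronecker, Matrix.trace_mul_comm]
  simp

end Ampliation

/-! ### Strong subadditivity from the monotonicity of the relative entropy -/

section SSA

/-- `S(ρ‖σ) = −S(ρ) − Re Tr(ρ log σ)` (unfolding with `Re Tr(ρ log ρ) = −S(ρ)`).
[cite: NielsenChuang2010, §11.3.1 eq. (11.50)] -/
private theorem quantumRelEntropy_eq_neg_entropy_sub {m : Type*} [Fintype m] [DecidableEq m]
    {ρ : Matrix m m ℂ} (hρ : ρ.IsHermitian) (σ : Matrix m m ℂ) :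
    quantumRelEntropy ρ σ = - vonNeumannEntropy ρ - ((ρ * cfc Real.log σ).trace).re := by
  unfold quantumRelEntropy
  rw [mul_sub, Matrix.trace_sub, Complex.sub_re, re_trace_mul_cfc_log hρ]

/-- `log(cN) = log N + log c · 𝟙` for positive definite `N` and `c ≠ 0` (the spectrum of `N` avoids
`0`). [folklore] -/
private theorem cfc_log_const_mul {k : Type*} [Fintype k] [DecidableEq k] {N : Matrix k k ℂ}
    (hN : N.PosDef) {c : ℝ} (hc : c ≠ 0) :
    cfc (fun x => Real.log (c * x)) N = cfc Real.log N + ((Real.log c : ℝ) : ℂ) • (1 : Matrix k k ℂ) := by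
  have hsa : IsSelfAdjoint N := hN.1
  calc cfc (fun x => Real.log (c * x)) N
      = cfc (fun x => Real.log x + (fun _ : ℝ => Real.log c) x) N := by
        refine cfc_congr fun x hx => ?_
        have hx0 : x ≠ 0 := by
          rintro rfl
          exact spectrum.zero_mem_iff ℝ |>.mp hx |> fun h => h hN.isUnit
        simp only [Real.log_mul hc hx0, add_comm]
    _ = cfc Real.log N + cfc (fun _ : ℝ => Real.log c) N :=
        cfc_add (a := N) Real.log (fun _ : ℝ => Real.log c)
          (Literature.LinearAlgebra.Matrix.cfc_continuousOn N _)
          (Literature.LinearAlgebra.Matrix.cfc_continuousOn N _)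
    _ = cfc Real.log N + ((Real.log c : ℝ) : ℂ) • (1 : Matrix k k ℂ) := by
        rw [cfc_const (Real.log c) N hsa, Algebra.algebraMap_eq_smul_one]
        congr 1

variable {A B C : Type} [Fintype A] [Fintype B] [Fintype C] [DecidableEq A] [DecidableEq B]
  [DecidableEq C]

omit [Fintype B] [DecidableEq A] [DecidableEq B] [DecidableEq C] in
/-- The two routes to the middle marginal agree: `Tr_C (Tr_A τ) = Tr_A (Tr_C τ)`.
[cite: NielsenChuang2010, §2.4.3 eq. (2.178)] -/
theorem traceRight_traceLeft_eq_traceLeft_traceLast (τ : Matrix (A × B × C) (A × B × C) ℂ) :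
    traceRight (traceLeft τ) = traceLeft (traceLast τ) := by
  ext b b'
  simp only [traceRight_apply, traceLeft_apply, traceLast_apply]
  exact Finset.sum_comm

omit [Fintype B] in
/-- `Tr_C 𝟙_{BC} = |C| · 𝟙_B`. [cite: NielsenChuang2010, §2.4.3 eq. (2.178)] -/
private theorem traceRight_one : traceRight (1 : Matrix (B × C) (B × C) ℂ) = (Fintype.card C : ℂ) • 1 := by
  rw [← Matrix.one_kronecker_one,
    Literature.MathematicalPhysics.QuantumLattice.traceRight_kronecker, Matrix.trace_one]

omit [Fintype C] in
/-- `Tr_B 𝟙_{BC} = |B| · 𝟙_C`. [cite: NielsenChuang2010, §2.4.3 eq. (2.178)] -/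
private theorem traceLeft_one : traceLeft (1 : Matrix (B × C) (B × C) ℂ) = (Fintype.card B : ℂ) • 1 := by
  rw [← Matrix.one_kronecker_one,
    Literature.MathematicalPhysics.QuantumLattice.traceLeft_kronecker, Matrix.trace_one]

/-- **The variational form of strong subadditivity** obtained from ONE application of the
monotonicity of the relative entropy under `Tr_C` (Lindblad's inequality) at the pair
`(τ, 𝟙_A/|A| ⊗ ω)`: for a density `τ` on `A × B × C` and every POSITIVE DEFINITE density `ω` on
`B × C` (with positive definite marginals),
`Re Tr(τ_{BC} log ω) − Re Tr(τ_B log ω_B) ≤ S(τ_{AB}) − S(τ)`.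
(`S(τ‖𝟙/|A| ⊗ ω) = −S(τ) − Tr τ_{BC} log ω + log|A|`, and the same one level down; the
`log|A|` cancel.) At `ω = τ_{BC}` (when it is faithful) this IS strong subadditivity
`S(τ) + S(τ_B) ≤ S(τ_{AB}) + S(τ_{BC})`; in general one lets `ω → τ_{BC}`.
[cite: Ruskai2002, §1.2 eqs. (6)–(7) ("Strong subadditivity can now be restated as
H(ρ₁₂,ρ₂) ≤ H(ρ₁₂₃,ρ₂₃) … This monotonicity implies (6) when Φ = T₃ is the partial trace")]
[cite: NielsenChuang2010, Corollary 11.13 (proof) eqs. (11.104)–(11.106) p.521; Theorem 11.17 p.524]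
[cite: Lindblad1975, Lemma 2 p.149] -/
theorem re_trace_log_sub_le_entropy_sub (h : relEntropy_partialTrace_le) [Nonempty A]
    (τ : Matrix (A × B × C) (A × B × C) ℂ) (hτ : IsDensity τ) {ω : Matrix (B × C) (B × C) ℂ}
    (hω : ω.PosDef) (hωtr : ω.trace = 1) (hωB : (traceRight ω).PosDef)
    (hωC : (traceLeft ω).PosDef) :
    ((traceLeft τ * cfc Real.log ω).trace).re
        - ((traceLeft (traceLast τ) * cfc Real.log (traceRight ω)).trace).re ≤
      vonNeumannEntropy (traceLast τ) - vonNeumannEntropy τ := by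
  set e := Equiv.prodAssoc A B C with he
  have hA : (0 : ℝ) < Fintype.card A := Nat.cast_pos.mpr Fintype.card_pos
  set c : ℝ := (Fintype.card A : ℝ)⁻¹ with hc
  have hc0 : 0 < c := inv_pos.mpr hA
  set D : Matrix A A ℂ := diagonal (fun _ : A => (c : ℂ)) with hD
  have hDpd : D.PosDef := Matrix.posDef_diagonal_iff.mpr fun _ => Complex.zero_lt_real.mpr hc0
  have hDtr : D.trace = 1 := by
    rw [hD, Matrix.trace_diagonal, Finset.sum_const, Finset.card_univ, nsmul_eq_mul, hc]
    push_cast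
    exact mul_inv_cancel₀ (by exact_mod_cast hA.ne')
  set σ₀ : Matrix (A × (B × C)) (A × (B × C)) ℂ := D ⊗ₖ ω with hσ₀
  have hσ₀pd : σ₀.PosDef := hDpd.kronecker hω
  set τ' : Matrix ((A × B) × C) ((A × B) × C) ℂ := τ.submatrix e e with hτ'
  set σ' : Matrix ((A × B) × C) ((A × B) × C) ℂ := σ₀.submatrix e e with hσ'
  have hτ'd : IsDensity τ' :=
    ⟨hτ.1.submatrix e, by rw [hτ', trace_submatrix_equiv_equiv]; exact hτ.2⟩
  have hσ'pd : σ'.PosDef := hσ₀pd.submatrix e.injective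
  have hσ'd : IsDensity σ' := ⟨hσ'pd.posSemidef, by
    rw [hσ', trace_submatrix_equiv_equiv, hσ₀, Matrix.trace_kronecker, hDtr, hωtr, one_mul]⟩
  have hσ'R : traceRight σ' = D ⊗ₖ traceRight ω := traceRight_kronecker_submatrix_prodAssoc D ω
  have hσ'L : traceLeft σ' = traceLeft ω := by
    rw [hσ', hσ₀, traceLeft_kronecker_submatrix_prodAssoc, hDtr, one_smul]
  have hd := (h (A × B) C τ' σ' hτ'd hσ'd hσ'pd (by rw [hσ'L]; exact hωC)
    (by rw [hσ'R]; exact hDpd.kronecker hωB)).2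
  have hH1 : (traceRight τ').IsHermitian := (posSemidef_traceRight hτ'd.1).isHermitian
  rw [quantumRelEntropy_eq_neg_entropy_sub hH1, quantumRelEntropy_eq_neg_entropy_sub hτ'd.1.1] at hd
  -- the logarithms of the comparison state and of its marginal
  have hlogσ₀ : cfc Real.log σ₀ =
      (1 : Matrix A A ℂ) ⊗ₖ cfc Real.log ω + ((Real.log c : ℝ) : ℂ) • (1 : Matrix (A × (B × C)) _ ℂ) := by
    rw [hσ₀, hD, cfc_diagonal_kronecker hω.isHermitian c Real.log, cfc_log_const_mul hω hc0.ne',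
      Matrix.kronecker_add, Matrix.kronecker_smul, Matrix.one_kronecker_one]
  have hlogR : cfc Real.log (traceRight σ') = (1 : Matrix A A ℂ) ⊗ₖ cfc Real.log (traceRight ω) +
      ((Real.log c : ℝ) : ℂ) • (1 : Matrix (A × B) (A × B) ℂ) := by
    rw [hσ'R, hD, cfc_diagonal_kronecker hωB.isHermitian c Real.log, cfc_log_const_mul hωB hc0.ne',
      Matrix.kronecker_add, Matrix.kronecker_smul, Matrix.one_kronecker_one]
  -- the two `Re Tr(ρ log σ)` terms
  have ht1 : ((τ' * cfc Real.log σ').trace).re = ((cfc Real.log ω * traceLeft τ).trace).re + Real.log c := by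
    rw [hσ', cfc_submatrix_equiv hσ₀pd.isHermitian e Real.log, hτ', Matrix.submatrix_mul_equiv,
      trace_submatrix_equiv_equiv, hlogσ₀, re_trace_mul_one_kronecker_add_smul_one, hτ.2,
      Complex.one_re, mul_one]
  have ht2 : ((traceRight τ' * cfc Real.log (traceRight σ')).trace).re =
      ((cfc Real.log (traceRight ω) * traceLeft (traceLast τ)).trace).re + Real.log c := by
    have hRτ : traceRight τ' = traceLast τ := rfl
    rw [hlogR, re_trace_mul_one_kronecker_add_smul_one, hRτ, trace_traceLast, hτ.2, Complex.one_re,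
      mul_one]
  have hS' : vonNeumannEntropy τ' = vonNeumannEntropy τ := vonNeumannEntropy_submatrix_equiv hτ.1.1 e
  have hRτ : traceRight τ' = traceLast τ := rfl
  rw [ht1, ht2, hS', hRτ] at hd
  rw [Matrix.trace_mul_comm (traceLeft τ), Matrix.trace_mul_comm (traceLeft (traceLast τ))]
  linarith

omit [DecidableEq A] in
/-- A density matrix is indexed by a nonempty type (its trace is `1`). [folklore] -/
private theorem nonempty_of_isDensity {m : Type*} [Fintype m] {ρ : Matrix m m ℂ} (hρ : IsDensity ρ) :
    Nonempty m := by
  by_contra hm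
  rw [not_nonempty_iff] at hm
  have h := hρ.2
  simp [Matrix.trace] at h

/-- **Strong subadditivity of the von Neumann entropy from the monotonicity of the relative entropy
under the partial trace** (Lieb–Ruskai's theorem, in the tree's tripartite vocabulary with the
shared system in the middle): for every density operator `τ` on `ℋ_A ⊗ ℋ_B ⊗ ℋ_C`,
`S(τ) + S(τ_B) ≤ S(τ_{AB}) + S(τ_{BC})`, where `τ_{AB} = Tr_C τ = traceLast τ`,
`τ_{BC} = Tr_A τ = traceLeft τ`, `τ_B = Tr_A τ_{AB}`. PROVED from the named fact
`relEntropy_partialTrace_le` (Lindblad 1975): the variational inequality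
`re_trace_log_sub_le_entropy_sub` at the regularised states `ω_ε = (1−ε) τ_{BC} + ε𝟙/(|B||C|)`
(positive definite, with positive definite marginals `(1−ε) τ_B + ε𝟙/|B|`, `(1−ε) τ_C + ε𝟙/|C|`),
and `ε → 0⁺` by `tendsto_re_trace_mul_cfc_log_perturb`. [cite: LiebRuskai1973, Theorem 2]
[cite: NielsenChuang2010, Theorem 11.14 eq. (11.108) p.521; Theorem 11.17 p.524]
[cite: Ruskai2002, §1.2 eqs. (6)–(7) and §5.3 ("MONO ⇒ MPT ⇔ SSA")] [cite: Lindblad1975, Lemma 2 p.149] -/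
theorem strongSubadditivity_of_relEntropy_partialTrace_le (h : relEntropy_partialTrace_le)
    (τ : Matrix (A × B × C) (A × B × C) ℂ) (hτ : IsDensity τ) :
    vonNeumannEntropy τ + vonNeumannEntropy (traceLeft (traceLast τ)) ≤
      vonNeumannEntropy (traceLast τ) + vonNeumannEntropy (traceLeft τ) := by
  obtain ⟨⟨a0, b0, c0⟩⟩ := nonempty_of_isDensity hτ
  haveI : Nonempty A := ⟨a0⟩
  have hB : (0 : ℝ) < Fintype.card B := Nat.cast_pos.mpr (Fintype.card_pos_iff.mpr ⟨b0⟩)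
  have hC : (0 : ℝ) < Fintype.card C := Nat.cast_pos.mpr (Fintype.card_pos_iff.mpr ⟨c0⟩)
  have hBC : (0 : ℝ) < Fintype.card (B × C) := by
    rw [Fintype.card_prod, Nat.cast_mul]; exact mul_pos hB hC
  have hBne : ((Fintype.card B : ℕ) : ℂ) ≠ 0 := by exact_mod_cast (Fintype.card_pos_iff.mpr ⟨b0⟩).ne'
  have hCne : ((Fintype.card C : ℕ) : ℂ) ≠ 0 := by exact_mod_cast (Fintype.card_pos_iff.mpr ⟨c0⟩).ne'
  set τBC := traceLeft τ with hτBC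
  set τB := traceLeft (traceLast τ) with hτB
  have hτBCd : IsDensity τBC := isDensity_traceLeft hτ
  have hτABd : IsDensity (traceLast τ) := isDensity_traceRight ⟨hτ.1.submatrix _, by
    rw [trace_submatrix_equiv_equiv]; exact hτ.2⟩
  have hτBd : IsDensity τB := isDensity_traceLeft hτABd
  have hτCd : IsDensity (traceLeft τBC) := isDensity_traceLeft hτBCd
  have hτB' : traceRight τBC = τB := traceRight_traceLeft_eq_traceLeft_traceLast τ
  -- the inequality at every regularised `ω_ε`, `0 < ε < 1`
  have key : ∀ ε : ℝ, 0 < ε → ε < 1 →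
      ((τBC * cfc Real.log (((1 - ε : ℝ) : ℂ) • τBC +
          ((ε * (Fintype.card (B × C) : ℝ)⁻¹ : ℝ) : ℂ) • (1 : Matrix (B × C) (B × C) ℂ))).trace).re
        - ((τB * cfc Real.log (((1 - ε : ℝ) : ℂ) • τB +
          ((ε * (Fintype.card B : ℝ)⁻¹ : ℝ) : ℂ) • (1 : Matrix B B ℂ))).trace).re ≤
      vonNeumannEntropy (traceLast τ) - vonNeumannEntropy τ := by
    intro ε hε hε1
    have h1ε : (0 : ℂ) ≤ ((1 - ε : ℝ) : ℂ) := Complex.zero_le_real.mpr (by linarith)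
    have hpos : ∀ {d : ℝ}, 0 < d → (0 : ℂ) < ((ε * d⁻¹ : ℝ) : ℂ) := fun hd =>
      Complex.zero_lt_real.mpr (mul_pos hε (inv_pos.mpr hd))
    set ω := ((1 - ε : ℝ) : ℂ) • τBC +
      ((ε * (Fintype.card (B × C) : ℝ)⁻¹ : ℝ) : ℂ) • (1 : Matrix (B × C) (B × C) ℂ) with hω
    have hωpd : ω.PosDef :=
      Matrix.PosDef.posSemidef_add (hτBCd.1.smul h1ε) (Matrix.PosDef.one.smul (hpos hBC))
    have hωtr : ω.trace = 1 := by
      rw [hω, Matrix.trace_add, Matrix.trace_smul, Matrix.trace_smul, hτBCd.2, Matrix.trace_one,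
        smul_eq_mul, smul_eq_mul, mul_one]
      push_cast
      rw [mul_assoc, inv_mul_cancel₀ (by exact_mod_cast hBC.ne')]
      ring
    have hωR : traceRight ω = ((1 - ε : ℝ) : ℂ) • τB +
        ((ε * (Fintype.card B : ℝ)⁻¹ : ℝ) : ℂ) • (1 : Matrix B B ℂ) := by
      rw [hω, Literature.MathematicalPhysics.QuantumLattice.traceRight_add,
        Literature.MathematicalPhysics.QuantumLattice.traceRight_smul,
        Literature.MathematicalPhysics.QuantumLattice.traceRight_smul, hτB', traceRight_one, smul_smul]
      congr 2
      rw [Fintype.card_prod]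
      push_cast
      rw [mul_inv, mul_assoc, mul_assoc, inv_mul_cancel₀ hCne, mul_one]
    have hωL : traceLeft ω = ((1 - ε : ℝ) : ℂ) • traceLeft τBC +
        ((ε * (Fintype.card C : ℝ)⁻¹ : ℝ) : ℂ) • (1 : Matrix C C ℂ) := by
      rw [hω, Literature.MathematicalPhysics.QuantumLattice.traceLeft_add,
        Literature.MathematicalPhysics.QuantumLattice.traceLeft_smul,
        Literature.MathematicalPhysics.QuantumLattice.traceLeft_smul, traceLeft_one, smul_smul]
      congr 2
      rw [Fintype.card_prod]
      push_cast
      rw [mul_comm ((Fintype.card B : ℕ) : ℂ), mul_inv, mul_assoc, mul_assoc, inv_mul_cancel₀ hBne,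
        mul_one]
    have hωRpd : (traceRight ω).PosDef := by
      rw [hωR]
      exact Matrix.PosDef.posSemidef_add (hτBd.1.smul h1ε) (Matrix.PosDef.one.smul (hpos hB))
    have hωLpd : (traceLeft ω).PosDef := by
      rw [hωL]
      exact Matrix.PosDef.posSemidef_add (hτCd.1.smul h1ε) (Matrix.PosDef.one.smul (hpos hC))
    have hV := re_trace_log_sub_le_entropy_sub h τ hτ hωpd hωtr hωRpd hωLpd
    rw [hωR] at hV
    exact hV
  -- the limit `ε → 0⁺`
  have hlim := (tendsto_re_trace_mul_cfc_log_perturb hτBCd.1 (Fintype.card (B × C) : ℝ)⁻¹).sub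
    (tendsto_re_trace_mul_cfc_log_perturb hτBd.1 (Fintype.card B : ℝ)⁻¹)
  have hev : ∀ᶠ ε in 𝓝[>] (0 : ℝ),
      ((τBC * cfc Real.log (((1 - ε : ℝ) : ℂ) • τBC +
          ((ε * (Fintype.card (B × C) : ℝ)⁻¹ : ℝ) : ℂ) • (1 : Matrix (B × C) (B × C) ℂ))).trace).re
        - ((τB * cfc Real.log (((1 - ε : ℝ) : ℂ) • τB +
          ((ε * (Fintype.card B : ℝ)⁻¹ : ℝ) : ℂ) • (1 : Matrix B B ℂ))).trace).re ≤
      vonNeumannEntropy (traceLast τ) - vonNeumannEntropy τ := by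
    filter_upwards [Ioo_mem_nhdsGT (zero_lt_one' ℝ)] with ε hε using key ε hε.1 hε.2
  have hle := le_of_tendsto hlim hev
  linarith

end SSA

/-! ### The theorem: weak monotonicity by purification -/

section Purification

/-- Reindexing a quadruple sum `Σ_{(s,x,k)} Σ_y` as `Σ_{(x,s,y)} Σ_k`. [folklore] -/
private theorem sum_reindex_purification {X S Y T : Type*} [Fintype X] [Fintype S] [Fintype Y]
    [Fintype T] (g : X → S → Y → T → ℂ) :
    ∑ p : S × X × T, ∑ y : Y, g p.2.1 p.1 y p.2.2 = ∑ q : X × S × Y, ∑ k : T, g q.1 q.2.1 q.2.2 k := by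
  simp only [Fintype.sum_prod_type]
  rw [Finset.sum_comm]
  exact Finset.sum_congr rfl fun x _ => Finset.sum_congr rfl fun s _ => Finset.sum_comm

/-- **Weak monotonicity of the von Neumann entropy from the monotonicity of the relative entropy
under the partial trace**: the named fact `weak_monotonicity` (Lieb–Ruskai 1973; the tree's
`VonNeumannEntropyInequalities.lean`) FOLLOWS from the named fact `relEntropy_partialTrace_le`
(Lindblad 1975, ibid.) — strong subadditivity by one application of Lindblad's inequality and a
regularisation (`strongSubadditivity_of_relEntropy_partialTrace_le`), then PURIFICATION
(Nielsen–Chuang, proof of Theorem 11.14: the two forms (11.107) `S(A) + S(B) ≤ S(AC) + S(BC)` and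
(11.108) `S(ABC) + S(B) ≤ S(AB) + S(BC)` "are in fact equivalent … introduce an auxiliary system `R`
purifying the system `ABC`"; Exercise 11.24 is this direction). Concretely: `ρ = M Mᴴ` on
`T = X × S × Y` (`M` from `0 ≤ ρ ⇔ ρ = Bᴴ B`), the reshaped matrix `M₁ : (S × X × T) × Y`,
`τ = M₁ M₁ᴴ` = the marginal over `Y` of the pure state `vec M` on `T ⊗ T`; SSA for `τ` with `X`
in the middle, plus the mirror lemma `S(MMᴴ) = S(MᴴM)` twice (`S(τ) = S(ρ_Y)`,
`S(τ_{XT}) = S(ρ_{SY})`), is weak monotonicity for `ρ`. Consequently an entropy-constrained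
relaxation row conditional on both facts is conditional on `relEntropy_partialTrace_le` alone, and
a proof of that fact discharges both. [cite: LiebRuskai1973, Theorems 1–2]
[cite: NielsenChuang2010, Theorem 11.14 with proof (11.111)–(11.112) and Exercise 11.24 p.521;
Theorem 11.17 p.524] [cite: Ruskai2002, §1.2 eqs. (6)–(7), §3.3 ("SSA is equivalent to
S(ρ₄) + S(ρ₂) ≤ S(ρ₁₂) + S(ρ₁₄)"), §5.3] [cite: Lindblad1975, Lemma 2 p.149] -/
theorem weak_monotonicity_of_relEntropy_partialTrace_le (h : relEntropy_partialTrace_le) :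
    weak_monotonicity := by
  intro X S Y _ _ _ _ _ _ ρ hρ
  -- a square root: `ρ = M * Mᴴ`
  obtain ⟨Bm, hBm⟩ := CStarAlgebra.nonneg_iff_eq_star_mul_self.mp hρ.1.nonneg
  set M : Matrix (X × S × Y) (X × S × Y) ℂ := star Bm with hMdef
  have hρM : ρ = M * Mᴴ := by
    rw [hBm, hMdef, Matrix.star_eq_conjTranspose, Matrix.conjTranspose_conjTranspose]
  have hρe : ∀ p q : X × S × Y, ρ p q = ∑ k, M p k * star (M q k) := by
    intro p q
    rw [hρM, Matrix.mul_apply]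
    rfl
  -- the purification marginal `τ` on `S × X × T`, `T = X × S × Y`
  set M₁ : Matrix (S × X × (X × S × Y)) Y ℂ := Matrix.of fun p y => M (p.2.1, p.1, y) p.2.2 with hM₁
  set τ : Matrix (S × X × (X × S × Y)) (S × X × (X × S × Y)) ℂ := M₁ * M₁ᴴ with hτdef
  have hτe : ∀ p q : S × X × (X × S × Y),
      τ p q = ∑ y, M (p.2.1, p.1, y) p.2.2 * star (M (q.2.1, q.1, y) q.2.2) := by
    intro p q
    rw [hτdef, Matrix.mul_apply]
    rfl
  have hτtr : τ.trace = 1 := by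
    rw [← hρ.2]
    simp only [Matrix.trace, Matrix.diag_apply, hτe, hρe]
    exact sum_reindex_purification (fun x s y k => M (x, s, y) k * star (M (x, s, y) k))
  have hτ : IsDensity τ := ⟨Matrix.posSemidef_self_mul_conjTranspose M₁, hτtr⟩
  have key := strongSubadditivity_of_relEntropy_partialTrace_le h τ hτ
  -- (1) `S(τ) = S(ρ_Y)`: `τ = M₁ M₁ᴴ`, `ρ_Y = (M₁ᴴ M₁)ᵀ`
  have h1m : (M₁ᴴ * M₁)ᵀ = traceLeft (traceLeft ρ) := by
    ext y y'
    simp only [Matrix.transpose_apply, Matrix.mul_apply, Matrix.conjTranspose_apply, traceLeft_apply,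
      hρe, hM₁, Matrix.of_apply, Fintype.sum_prod_type]
    refine Finset.sum_congr rfl fun s _ => Finset.sum_congr rfl fun x _ =>
      Finset.sum_congr rfl fun k _ => Finset.sum_congr rfl fun _ _ =>
        Finset.sum_congr rfl fun _ _ => mul_comm _ _
  have h1 : vonNeumannEntropy τ = vonNeumannEntropy (traceLeft (traceLeft ρ)) := by
    rw [hτdef, vonNeumannEntropy_mul_conjTranspose_comm, ← h1m,
      vonNeumannEntropy_transpose (Matrix.isHermitian_conjTranspose_mul_self M₁)]
  -- (2) `τ_X = ρ_X`
  have h2 : traceLeft (traceLast τ) = traceRight (traceLast ρ) := by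
    ext x x'
    simp only [traceLeft_apply, traceRight_apply, traceLast_apply, hτe, hρe]
    refine Finset.sum_congr rfl fun s _ => Finset.sum_comm
  -- (3) `τ_{SX} = ρ_{XS}` up to the swap
  have h3m : traceLast τ = (traceLast ρ).submatrix (Equiv.prodComm S X) (Equiv.prodComm S X) := by
    ext ⟨s, x⟩ ⟨s', x'⟩
    simp only [Matrix.submatrix_apply, Equiv.prodComm_apply, Prod.swap_prod_mk, traceLast_apply,
      hτe, hρe]
    exact Finset.sum_comm
  have h3 : vonNeumannEntropy (traceLast τ) = vonNeumannEntropy (traceLast ρ) := by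
    rw [h3m]
    have hH : (traceLast ρ).IsHermitian :=
      (posSemidef_traceRight (hρ.1.submatrix _)).isHermitian
    exact vonNeumannEntropy_submatrix_equiv hH _
  -- (4) `S(τ_{XT}) = S(ρ_{SY})`: `τ_{XT} = M₂ M₂ᴴ`, `ρ_{SY} = (M₂ᴴ M₂)ᵀ`
  set M₂ : Matrix (X × (X × S × Y)) (S × Y) ℂ := Matrix.of fun p q => M (p.1, q.1, q.2) p.2 with hM₂
  have h4a : traceLeft τ = M₂ * M₂ᴴ := by
    ext ⟨x, k⟩ ⟨x', k'⟩
    simp only [traceLeft_apply, hτe, Matrix.mul_apply, Matrix.conjTranspose_apply, hM₂,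
      Matrix.of_apply, Fintype.sum_prod_type]
  have h4b : (M₂ᴴ * M₂)ᵀ = traceLeft ρ := by
    ext ⟨s, y⟩ ⟨s', y'⟩
    simp only [Matrix.transpose_apply, Matrix.mul_apply, Matrix.conjTranspose_apply, traceLeft_apply,
      hρe, hM₂, Matrix.of_apply, Fintype.sum_prod_type]
    exact Finset.sum_congr rfl fun x _ => Finset.sum_congr rfl fun k _ => Finset.sum_congr rfl
      fun _ _ => Finset.sum_congr rfl fun _ _ => mul_comm _ _
  have h4 : vonNeumannEntropy (traceLeft τ) = vonNeumannEntropy (traceLeft ρ) := by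
    rw [h4a, vonNeumannEntropy_mul_conjTranspose_comm, ← h4b,
      vonNeumannEntropy_transpose (Matrix.isHermitian_conjTranspose_mul_self M₂)]
  rw [h1, h2, h3, h4] at key
  linarith

/-- **Weak monotonicity HOLDS** — discharge of the named fact `weak_monotonicity` (Lieb–Ruskai
1973): `theorem weak_monotonicity_holds : weak_monotonicity`, from the tree's discharge
`relEntropy_partialTrace_le_holds` of Lindblad's inequality (`VonNeumannEntropyInequalities.lean`,
Petz's relative-modular-operator proof) through the bridge
`weak_monotonicity_of_relEntropy_partialTrace_le`. For every density operator `ρ` on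
`ℋ_X ⊗ ℋ_S ⊗ ℋ_Y`: `S(ρ_X) + S(ρ_Y) ≤ S(ρ_{XS}) + S(ρ_{SY})`. Users' `(h : weak_monotonicity)` are fed
`weak_monotonicity_holds`. (Stated in this module rather than appended to the fact's file because
the proof imports that file.) [cite: LiebRuskai1973, Theorems 1–2]
[cite: NielsenChuang2010, Theorem 11.14 eq. (11.107) p.521] -/
theorem weak_monotonicity_holds : weak_monotonicity :=
  weak_monotonicity_of_relEntropy_partialTrace_le relEntropy_partialTrace_le_holds

end Purification

end Literature.InformationTheory.Entropy
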